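import Mathlib.GroupTheory.Perm.Cycle.Type
import Mathlib.Tactic.IntervalCases
import Literature.NumberTheory.Automorphic.DefiniteOrderUnitsFinite
import Literature.NumberTheory.Automorphic.BrandtMatrixUnitCount
import Literature.NumberTheory.Automorphic.QuaternionOrderIntegral
import Literature.NumberTheory.Automorphic.BrandtModule
import Literature.NumberTheory.Automorphic.BrandtWeightSymmetry
import Literature.NumberTheory.Automorphic.QuaternionInvolutionToolkit
import HarnessLib

/-!
# Units of definite quaternion orders have order dividing `12`; primes `p ≥ 5` do not divide
# the Brandt weights `w_i`

Topic `NumberTheory/Automorphic`; theorems only (no definition, no named fact, no instance).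
Let `D` be a totally definite quaternion algebra over `ℚ` and `O ⊆ D` a `ℤ`-order. A unit `u` of
`O` has reduced norm `1` (`Brandt.IsOrder.exists_inv_mem_iff_of_isTotallyDefinite`, Vignéras I §4
Lemme 4.12 with III §3) and integral reduced trace `t` with `t² ≤ 4` (the norm form is positive
definite: `0 ≤ nrd(2u − t) = 4 − t²`); from `u² = t u − 1` one reads off `u = ±1`, `u² = −1`,
`u³ = −1` or `u³ = 1` according as `t = ±2, 0, 1, −1`. Hence:

* `Brandt.pow_twelve_eq_one_of_unit` — **`u¹² = 1`** for every unit of `O`;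
  `Brandt.orderOf_dvd_twelve_of_mem_stabilizer` — the elements of the stabiliser
  `Stab_{Dˣ}(I) = O_L(I)ˣ` of a full lattice have order dividing `12`;
* `Brandt.not_dvd_card_stabilizer` — by Cauchy's theorem, **no prime `p ≥ 5` divides
  `|O_L(I)ˣ|`**; consequently `p ∤ w` for the Brandt weights `w_i = |O_L(I_i)ˣ| / 2`:
  `Brandt.not_dvd_weight` (`BrandtXi.lean` weights, any order datum of a totally definite `D`),
  `Brandt.XiSetup.not_dvd_weight`, and `EichlerPackage.not_dvd_w` (`BrandtModule.lean` weights).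

This is the observation that makes the two normalisations of the height pairing on the Brandt
module (`⟨e_i, e_j⟩ = w_i δ_ij` versus `δ_ij`) and of its Hecke-eigenvector (Brandt matrix versus
its transpose, eigenvectors differing by `diag(w)`) invisible to `ord_p` for `p ≥ 5` — the range
of primes of Pollack–Weston 2011, Thm. 6.8 for elliptic curves (`PollackWestonCongruence.lean`).

## References

* M.-F. Vignéras, *Arithmétique des algèbres de quaternions*, LNM 800 (1980), Ch. I §4
  Lemme 4.12, Ch. V §2 Cor. 2.3 [VignerasLNM800].
* B. H. Gross, *Heights and the special values of L-series*, CMS Conf. Proc. 7 (1987), §1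
  [Gross1987].
-/

noncomputable section

open scoped Pointwise

universe u

namespace Literature.NumberTheory.Automorphic

namespace Brandt

variable {D : Type u} [Ring D] [Algebra ℚ D] [IsQuaternionAlgebra ℚ D]

/-! ### Trace bound and the order of a unit -/

/-- **In a totally definite quaternion algebra an element of reduced norm `1` has
`trd(x)² ≤ 4`**: `0 ≤ nrd(2x − trd x) = 4 − trd(x)²`. [folklore] -/
theorem reducedTrace_sq_le_four (hdef : IsTotallyDefinite ℚ D) {x : D}
    (hx : reducedNorm ℚ D x = 1) : reducedTrace ℚ D x ^ 2 ≤ 4 := by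
  set t := reducedTrace ℚ D x with ht
  have h := reducedNorm_nonneg_of_isTotallyDefinite D hdef ((2 : ℚ) • x - algebraMap ℚ D t)
  rw [reducedNorm_sub, reducedNorm_smul, hx, reducedNorm_algebraMap, standardInvolution_algebraMap,
    smul_mul_assoc, map_smul, ← Algebra.commutes, ← Algebra.smul_def, map_smul, ← ht] at h
  simp only [smul_eq_mul] at h
  nlinarith [h]

/-- **A unit of a `ℤ`-order in a totally definite quaternion algebra over `ℚ` satisfies
`u¹² = 1`** (its reduced norm is `1`, its trace `t ∈ {0, ±1, ±2}`, and `u² = t u − 1`). [cite: VignerasLNM800, Ch. I §4 Lemme 4.12] -/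
theorem pow_twelve_eq_one_of_unit (hdef : IsTotallyDefinite ℚ D) {O : Submodule ℤ D}
    (hO : IsOrder D O) {u : D} (hu : u ∈ O) (hinv : ∃ y ∈ O, u * y = 1 ∧ y * u = 1) :
    u ^ 12 = 1 := by
  have hdiv : ∀ x : D, x ≠ 0 → IsUnit x := fun x hx => isUnit_of_isTotallyDefinite D hdef hx
  have hn : reducedNorm ℚ D u = 1 := (hO.exists_inv_mem_iff_of_isTotallyDefinite hdef hu).mp hinv
  obtain ⟨t, -, ht, -⟩ := hO.exists_int_reducedTrace_reducedNorm hu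
  have htsq : (t : ℚ) ^ 2 ≤ 4 := ht ▸ reducedTrace_sq_le_four hdef hn
  have htsq' : t ^ 2 ≤ 4 := by exact_mod_cast htsq
  have ht2 : -2 ≤ t ∧ t ≤ 2 := by constructor <;> nlinarith [htsq', sq_nonneg (t + 2), sq_nonneg (t - 2)]
  -- `u u = t u - 1`
  have huu : u * u = (t : ℚ) • u - 1 := by
    rw [mul_self_eq_smul_sub ℚ u, ht, hn, map_one]
  -- a square-zero element is zero in a division algebra
  have sq_zero : ∀ a : D, a * a = 0 → a = 0 := fun a ha => by
    by_contra h
    obtain ⟨w, hw⟩ := hdiv a h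
    have : (w : D) = 0 := by
      have := congrArg (fun y => (↑w⁻¹ : D) * y) ha
      simpa [← hw, ← mul_assoc] using this
    exact h (hw ▸ this)
  obtain ⟨hlo, hhi⟩ := ht2
  interval_cases t
  · -- `t = -2`: `(u + 1)² = 0`, `u = -1`
    have huu' : u * u = -(u + u) - 1 := by rw [huu]; push_cast; rw [neg_smul, two_smul]
    have h : (u + 1) * (u + 1) = 0 := by
      rw [add_mul, mul_add, mul_one, one_mul, huu']; abel
    have hu1 : u = -1 := eq_neg_of_add_eq_zero_left (sq_zero _ h)
    rw [hu1]; norm_num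
  · -- `t = -1`: `u³ = 1`
    have huu' : u * u = -u - 1 := by rw [huu]; push_cast; rw [neg_smul, one_smul]
    have h3 : u ^ 3 = 1 := by
      rw [pow_succ, sq, huu', sub_mul, neg_mul, huu', one_mul]; abel
    rw [show (12 : ℕ) = 3 * 4 by norm_num, pow_mul, h3, one_pow]
  · -- `t = 0`: `u² = -1`
    have h2 : u ^ 2 = -1 := by rw [sq, huu]; simp
    rw [show (12 : ℕ) = 2 * 6 by norm_num, pow_mul, h2]; norm_num
  · -- `t = 1`: `u³ = -1`
    have huu' : u * u = u - 1 := by rw [huu]; push_cast; rw [one_smul]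
    have h3 : u ^ 3 = -1 := by
      rw [pow_succ, sq, huu', sub_mul, one_mul, huu']; abel
    rw [show (12 : ℕ) = 3 * 4 by norm_num, pow_mul, h3]; norm_num
  · -- `t = 2`: `(u - 1)² = 0`, `u = 1`
    have huu' : u * u = (u + u) - 1 := by rw [huu]; push_cast; rw [two_smul]
    have h : (u - 1) * (u - 1) = 0 := by
      rw [sub_mul, mul_sub, mul_one, one_mul, huu']; abel
    have hu1 : u = 1 := sub_eq_zero.mp (sq_zero _ h)
    rw [hu1, one_pow]

/-- **The elements of the stabiliser `Stab_{Dˣ}(I) = O_L(I)ˣ` of a full lattice have order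
dividing `12`.** [cite: VignerasLNM800, Ch. I §4 Lemme 4.12] -/
theorem orderOf_dvd_twelve_of_mem_stabilizer (hdef : IsTotallyDefinite ℚ D) {I : Submodule ℤ D}
    (hI : IsFullLattice D I) {u : Dˣ} (hu : u ∈ MulAction.stabilizer Dˣ I) : orderOf u ∣ 12 := by
  haveI : IsAddTorsionFree D := isAddTorsionFree_of_charZero_module ℚ D
  obtain ⟨h1, h2⟩ := (mem_stabilizer_iff_mem_leftOrder I u).mp hu
  refine orderOf_dvd_of_pow_eq_one (Units.ext ?_)
  rw [Units.val_pow_eq_pow_val, Units.val_one]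
  exact pow_twelve_eq_one_of_unit hdef (isOrder_leftOrder hI) h1
    ⟨_, h2, by rw [Units.mul_inv], by rw [Units.inv_mul]⟩

/-- **No prime `p ≥ 5` divides `|O_L(I)ˣ| = |Stab_{Dˣ}(I)|`** for a full lattice `I` of a totally
definite quaternion algebra over `ℚ` (Cauchy's theorem: an element of order `p` would have order
dividing `12`). [folklore] -/
theorem not_dvd_card_stabilizer (hdef : IsTotallyDefinite ℚ D) {I : Submodule ℤ D}
    (hI : IsFullLattice D I) {p : ℕ} (hp : p.Prime) (h5 : 5 ≤ p) :
    ¬ p ∣ Nat.card (MulAction.stabilizer Dˣ I) := by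
  haveI : Fact p.Prime := ⟨hp⟩
  obtain ⟨e⟩ := nonempty_stabilizerEquivUnits I
  have hfin : Finite {x : D // x ∈ leftOrder I ∧ ∃ y ∈ leftOrder I, x * y = 1 ∧ y * x = 1} :=
    (finite_units_leftOrder hdef hI).to_subtype
  haveI : Finite (MulAction.stabilizer Dˣ I) := Finite.of_equiv _ e.symm
  intro hdvd
  obtain ⟨g, hg⟩ := exists_prime_orderOf_dvd_card' p hdvd
  have h12 : orderOf g ∣ 12 := by
    rw [← Subgroup.orderOf_coe]  -- `orderOf (g : Dˣ) = orderOf g`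
    exact orderOf_dvd_twelve_of_mem_stabilizer hdef hI g.2
  rw [hg] at h12
  have hle : p ≤ 12 := Nat.le_of_dvd (by norm_num) h12
  interval_cases p <;> simp_all (config := {decide := true})

/-- **`p ∤ w` for the Brandt weights `w = weight O c = |O_L(I_c)ˣ| / 2` and primes `p ≥ 5`**
(any order datum `O` of a totally definite quaternion algebra over `ℚ`; the classes consist of
full lattices). [folklore] -/
theorem not_dvd_weight (hdef : IsTotallyDefinite ℚ D) (O : Submodule ℤ D) (c : ClassSet O) {p : ℕ}
    (hp : p.Prime) (h5 : 5 ≤ p) : ¬ p ∣ weight O c := by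
  intro h
  have hne : (1 : D) ≠ -1 := one_ne_neg_one_rat
  have hcard := card_stabilizer_eq_two_mul_unitIndex hne c.rep
  have : p ∣ Nat.card (MulAction.stabilizer Dˣ c.rep) := by
    rw [hcard]
    exact Dvd.dvd.mul_left h 2
  exact not_dvd_card_stabilizer hdef c.rep_mem.1 hp h5 this

/-- **`p ∤ w_c` for the weights of a Brandt setup of type `(N⁺, N⁻)`** and `p ≥ 5`. [folklore] -/
theorem XiSetup.not_dvd_weight {Nplus Nminus : ℕ} (S : XiSetup Nplus Nminus) (c : ClassSet S.O)
    {p : ℕ} (hp : p.Prime) (h5 : 5 ≤ p) : ¬ p ∣ weight S.O c :=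
  Brandt.not_dvd_weight S.isTotallyDefinite S.O c hp h5

end Brandt

/-- **`p ∤ w_i` for the weights of the Brandt data of an Eichler package** (`BrandtModule.lean`:
`w_i = |Stab(I_i)| / 2`) and primes `p ≥ 5`. [folklore] -/
theorem EichlerPackage.not_dvd_w {Nplus Nminus : ℕ} (P : EichlerPackage Nplus Nminus)
    (i : P.brandtData.ι) {p : ℕ} (hp : p.Prime) (h5 : 5 ≤ p) : ¬ p ∣ P.brandtData.w i := by
  intro h
  have hI := (RightIdealClass.isInvertibleRightIdeal_rep i).isFullLattice
  have hw : P.brandtData.w i = Nat.card (MulAction.stabilizer P.Bˣ (RightIdealClass.rep i)) / 2 :=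
    BrandtData.ofOrder_w P.O _ i
  have hne : (1 : P.B) ≠ -1 := Brandt.one_ne_neg_one_rat
  have h2 := Brandt.card_stabilizer_eq_two_mul_unitIndex hne (RightIdealClass.rep i)
  have : p ∣ Nat.card (MulAction.stabilizer P.Bˣ (RightIdealClass.rep i)) := by
    rw [h2] at hw ⊢
    rw [Nat.mul_div_cancel_left _ two_pos] at hw
    rw [← hw]
    exact Dvd.dvd.mul_left h 2
  exact Brandt.not_dvd_card_stabilizer P.isTotallyDefinite hI hp h5 this

end Literature.NumberTheory.Automorphic

end
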